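import Mathlib
import Literature.Analysis.FluidPDE.SelfSimilar
import Literature.Analysis.FluidPDE.AxisymmetricEuler
import Literature.Analysis.FluidPDE.TypeIAncientMild
import Literature.Analysis.FluidPDE.PineauVicolRSS
import Literature.Analysis.FluidPDE.OseenZoomCovariance
import Literature.Analysis.FluidPDE.OseenMildUniqueness
import Literature.Analysis.FluidPDE.PineauVicolRDSSLeray
import Literature.Analysis.FluidPDE.PineauVicolRSSChaeWolf
import Literature.Analysis.FluidPDE.PineauVicolRSSProofs
import Summits.NavierStokesRegularity.NavierStokesRegularity.Theorems.QuantisedSymmetryPolyhedralDssProfileExistsStubAncientMildOfClassicalTypeI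
import Summits.NavierStokesRegularity.NavierStokesRegularity.Theorems.DssFarFieldSlavingBlowupTypeIDssProfileSmoothRepresentativeAe
import Summits.NavierStokesRegularity.NavierStokesRegularity.Theorems.DssFarFieldSlavingBlowupTypeIDssProfileAxisymmetricEmpty
import Summits.NavierStokesRegularity.NavierStokesRegularity.Theorems.CorkscrewDynamoCorkscrewProfileAngleTools
import Summits.NavierStokesRegularity.NavierStokesRegularity.Theorems.DssFarFieldSlavingBlowupTypeIDssProfileMirrorCorotating
import HarnessLib

/-!
# T22′ — a MIRROR CANNOT ROTATE: the co-rotating reversing cell is EMPTY for time-dependent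
  (RDSS / arbitrary) co-rotating profiles, every angular speed `α ≠ 0`, every twist
  (route `DssFarFieldSlaving`, crux `BlowupTypeIDssProfile`, stmt-NavierStokesRegularity-0155 — SUPPORT;
  cell pub-ns-dss theory seat g3, red-team R-36 / lead A56 «K0d′ / T22′»; theory file
  HOME/theory/RotatingMirrorEmpty.lean sha256[16] 04da22f8a66afb94, landed by the typer — typer changes: the
  definition `rotMirror g φ` is written out as the isometry `((rotZLIE (−φ)).trans g).trans (rotZLIE φ)`,
  `isAxisymmetric_of_halfLine` is the landed `ReversingIsotropy.isAxisymmetric_of_halfLine`)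

HONEST FRAMING. A Liouville-type exclusion of ONE symmetry cell of the rotated-DSS census class of
`FilamentSkeletonRss.RdssProfileTruncation`; no claim about Navier–Stokes regularity or blow-up, no number.

MAIN LEMMA `equivariant_of_le` (**symmetries of a slice propagate forward**): if the
slice at time `t₀ < 0` of a Type-I ancient mild field (KNSS Oseen gauge) is equivariant under a linear
isometry `A`, then so is every later slice `t ∈ [t₀, 0)`. PROOF: the conjugated field `A⁻¹u(t, A·)` solves
the same Oseen integral equation from `t₀` (`oseenDuhamel_symm_conj_linearIsometryEquiv`,
`heatExtension_conj_linearIsometryEquiv`) with the same slice at `t₀` and the same bound, so forward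
uniqueness of bounded Oseen-mild fields (`oseenMild_bounded_unique`, KNSS 2009 §4) identifies the two.
Consequence: the isotropy group of the slices is NON-DECREASING in time.

THEOREM `rotatingMirror_trivial` (T22′, Oseen gauge): a Type-I ancient mild field with Type-I space–time
decay whose slice at log-time `s = −log(−t)` is equivariant under the ROTATING MIRROR
`R_{αs} g R_{−αs}` (`g` a rotation-reversing isometry, `g R_φ = R_{−φ} g`; `α ≠ 0`) for every `t < 0` is
identically zero. PROOF: by the main lemma the slice at `s` is equivariant under `R_{αs₀} g R_{−αs₀}` for
every `s₀ ≤ s` as well, hence under `(R_{αs} g R_{−αs})(R_{αs₀} g R_{−αs₀})⁻¹ = R_{2α(s−s₀)}`: a half-line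
of rotation angles, so every slice is axisymmetric (`isAxisymmetric_of_halfLine`, `2π`-periodicity) and
KNSS 2009 Thm 5.3 (`typeI_ancient_axisymmetric_ae_zero`) kills it. NO periodicity, NO self-similarity and
NO irrationality of the twist is used.

COROLLARIES. `corotatingMirror_rdss_trivial`: a field `pvAnsatz α W` (Pineau–Vicol (1.13a), co-rotating
profile `W(y, s)` depending on `s` — RDSS when `W` is `2 log c`-periodic, RSS when constant) with
`W(·, s)` equivariant under a FIXED rotation-reversing `g` for every `s`, `α ≠ 0`, Type-I ancient mild:
`W = 0`. Class level `rdssClass_corotatingMirror_empty` (ancient mild + measurable slices + Type-I `M`,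
continuous profile slices); window-classical RDSS form `corotatingMirror_rdss_liouville` (Pineau–Vicol 2026
Thm 1.7's setting + the mirror: classical on `[−1,0)`, Type-I there, `W` `2 log c`-periodic). T22
(`mirrorCorotating_trivial`, `s`-independent profile) is the special case `W y s = U y`.

CENSUS READING (red R-36 sharpened): the cell «K4 (RDSS, factor c, twist R_θ) × co-rotating frame of
speed α ≠ 0 (αL ≡ θ mod 2π, L = 2 log c) × co-rotating isotropy containing a rotation-REVERSING element
(C_nv, D_n, D_nh, D_nd co-rotating)» is THEOREM-EMPTY for EVERY twist — finite order included; the only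
reversing cell not covered is the non-rotating frame α = 0 (plain DSS with an inertial mirror / dihedral
isotropy: open). R-36's restriction to infinite-order twists is not needed.
[cite: KochNadirashviliSereginSverak2009, §4 and Thm 5.3 (arXiv:0709.3599)]
[cite: PineauVicol2026, (1.13a) and Theorem 1.7 (arXiv:2607.09619 p. 7)]
-/

noncomputable section

set_option linter.dupNamespace false

namespace Summit.NavierStokesRegularity.NavierStokesRegularity.Theorems.RotatingMirror

open MeasureTheory Set Function Filter Metric
open Literature.Analysis.FluidPDE
open Summit.NavierStokesRegularity.NavierStokesRegularity.Theorems
open scoped Topology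


/-- Rotations about the axis commute with scalar multiplication (via the bundled `rotZL`). -/
private theorem rotZ_smul'' (θ c : ℝ) (y : (EuclideanSpace ℝ (Fin 3))) : rotZ θ (c • y) = c • rotZ θ y := by
  rw [← rotZL_apply, map_smul, rotZL_apply]

/-- `rotZ θ` is continuous (via the bundled `rotZL θ`). -/
private theorem continuous_rotZ_map' (θ : ℝ) : Continuous (rotZ θ : (EuclideanSpace ℝ (Fin 3)) → (EuclideanSpace ℝ (Fin 3))) := by
  have : (rotZ θ : (EuclideanSpace ℝ (Fin 3)) → (EuclideanSpace ℝ (Fin 3))) = rotZL θ := by funext x; rw [rotZL_apply]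
  rw [this]; exact (rotZL θ).continuous

/-- Slices of a Type-I ancient mild field are continuous. -/
private theorem slice_continuous {C₀ : ℝ} {V : ℝ → (EuclideanSpace ℝ (Fin 3)) → (EuclideanSpace ℝ (Fin 3))} (hV : IsTypeIAncientMild C₀ V)
    {t : ℝ} (ht : t < 0) : Continuous (V t) := by
  have h : ContinuousOn (uncurry V ∘ fun x : (EuclideanSpace ℝ (Fin 3)) => (t, x)) univ :=
    hV.1.continuousOn.comp (continuous_const.prodMk continuous_id).continuousOn
      fun x _ => ⟨ht, mem_univ _⟩
  exact (continuousOn_univ.1 h).congr fun x => rfl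


/-! ### Main lemma: symmetries of a slice propagate forward -/

/-- **Symmetries propagate forward.** If the slice at `t₀ < 0` of a Type-I ancient mild field (KNSS Oseen
gauge) is equivariant under a linear isometry `A`, then every slice at `t ∈ [t₀, 0)` is `A`-equivariant:
the conjugated field `A⁻¹ V(t, A·)` solves the same Oseen integral equation from `t₀` with the same slice
and the same bound, and bounded Oseen-mild fields are unique forward in time (KNSS 2009 §4). -/
theorem equivariant_of_le {C₀ : ℝ} {V : ℝ → (EuclideanSpace ℝ (Fin 3)) → (EuclideanSpace ℝ (Fin 3))}
    (hV : IsTypeIAncientMild C₀ V) (A : (EuclideanSpace ℝ (Fin 3)) ≃ₗᵢ[ℝ] (EuclideanSpace ℝ (Fin 3))) {t₀ : ℝ} (ht₀ : t₀ < 0)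
    (hA : ∀ x, V t₀ (A x) = A (V t₀ x)) :
    ∀ t, t₀ ≤ t → t < 0 → ∀ x, V t (A x) = A (V t x) := by
  have hVc : ∀ t < 0, Continuous (V t) := fun t ht => slice_continuous hV ht
  have hC₀ : 0 ≤ C₀ := by
    have h1 := hV.2.2.2 t₀ ht₀ 0
    by_contra hneg
    have h2 : C₀ / Real.sqrt (-t₀) < 0 :=
      div_neg_of_neg_of_pos (lt_of_not_ge hneg) (Real.sqrt_pos.2 (by linarith))
    linarith [norm_nonneg (V t₀ 0)]
  -- the conjugated field and its slice at `t₀`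
  set W : ℝ → (EuclideanSpace ℝ (Fin 3)) → (EuclideanSpace ℝ (Fin 3)) := fun t x => A.symm (V t (A x)) with hW
  have hW1 : ∀ y, A.symm (V t₀ (A y)) = V t₀ y := fun y => by
    rw [hA, LinearIsometryEquiv.symm_apply_apply]
  -- both solve the Oseen equation from `t₀` with the same free term
  have hVeq : ∀ t ∈ Ioo t₀ 0, ∀ x,
      V t x = heatFlow (V t₀) (t - t₀) x - oseenDuhamel 1 t₀ V V t x :=
    fun t ht x => hV.2.2.1 t₀ t ht.1 ht.2 x
  have hWeq : ∀ t ∈ Ioo t₀ 0, ∀ x,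
      W t x = heatFlow (V t₀) (t - t₀) x - oseenDuhamel 1 t₀ W W t x := by
    intro t ht x
    have hpos : 0 < t - t₀ := by linarith [ht.1]
    show A.symm (V t (A x)) = _
    rw [hVeq t ht (A x), map_sub, heatFlow_of_pos _ hpos,
      oseenDuhamel_symm_conj_linearIsometryEquiv A 1 t₀ V V t x]
    congr 1
    have h := heatExtension_conj_linearIsometryEquiv A.symm (V t₀) (t - t₀) x
    simp only [LinearIsometryEquiv.symm_symm] at h
    rw [← h]
    congr 1
    funext y
    exact hW1 y
  -- forward uniqueness of bounded Oseen-mild fields: `V = W` on `(t₀, 0)`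
  have hVW : ∀ t ∈ Ioo t₀ 0, V t = W t := by
    intro t ht
    have hT0 : t / 2 < 0 := by linarith [ht.2]
    have htT : t < t / 2 := by linarith [ht.2]
    have hM0 : 0 ≤ C₀ / Real.sqrt (-(t / 2)) := div_nonneg hC₀ (Real.sqrt_nonneg _)
    have hbound : ∀ τ ∈ Ioo t₀ (t / 2), ∀ y, ‖V τ y‖ ≤ C₀ / Real.sqrt (-(t / 2)) := by
      intro τ hτ y
      have hτ0 : τ < 0 := lt_trans hτ.2 hT0
      calc ‖V τ y‖ ≤ C₀ / Real.sqrt (-τ) := hV.2.2.2 τ hτ0 y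
        _ ≤ C₀ / Real.sqrt (-(t / 2)) := by
          apply div_le_div_of_nonneg_left hC₀ (Real.sqrt_pos.2 (by linarith))
          exact Real.sqrt_le_sqrt (by linarith [hτ.2])
    have hboundW : ∀ τ ∈ Ioo t₀ (t / 2), ∀ y, ‖W τ y‖ ≤ C₀ / Real.sqrt (-(t / 2)) :=
      fun τ hτ y => by
        show ‖A.symm (V τ (A y))‖ ≤ _
        rw [LinearIsometryEquiv.norm_map]
        exact hbound τ hτ (A y)
    have hcontV : ContinuousOn (uncurry V) (Ioo t₀ (t / 2) ×ˢ univ) :=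
      hV.1.continuousOn.mono (prod_mono (fun τ hτ => lt_trans hτ.2 hT0) subset_rfl)
    have hmeasV : AEStronglyMeasurable (uncurry V)
        ((volume : Measure (ℝ × (EuclideanSpace ℝ (Fin 3)))).restrict (Ioo t₀ (t / 2) ×ˢ univ)) :=
      hcontV.aestronglyMeasurable (measurableSet_Ioo.prod MeasurableSet.univ)
    have hcontW : ContinuousOn (uncurry W) (Ioo t₀ (t / 2) ×ˢ univ) := by
      have hWf : uncurry W = A.symm ∘ uncurry V ∘ fun q : ℝ × (EuclideanSpace ℝ (Fin 3)) => (q.1, A q.2) := by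
        funext q; rfl
      rw [hWf]
      refine A.symm.continuous.comp_continuousOn (hcontV.comp
        (continuous_fst.prodMk (A.continuous.comp continuous_snd)).continuousOn ?_)
      intro q hq
      exact ⟨hq.1, mem_univ _⟩
    have hmeasW : AEStronglyMeasurable (uncurry W)
        ((volume : Measure (ℝ × (EuclideanSpace ℝ (Fin 3)))).restrict (Ioo t₀ (t / 2) ×ˢ univ)) :=
      hcontW.aestronglyMeasurable (measurableSet_Ioo.prod MeasurableSet.univ)
    have huniq := oseenMild_bounded_unique (u := V) (v := W)
      (U := fun τ x => heatFlow (V t₀) (τ - t₀) x) (s := t₀) (T := t / 2) one_pos hM0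
      hmeasV hmeasW hbound hboundW
      (fun τ hτ => Filter.Eventually.of_forall fun x => hVeq τ ⟨hτ.1, lt_trans hτ.2 hT0⟩ x)
      (fun τ hτ => Filter.Eventually.of_forall fun x => hWeq τ ⟨hτ.1, lt_trans hτ.2 hT0⟩ x)
    exact Measure.eq_of_ae_eq (huniq t ⟨ht.1, htT⟩) (hVc t ht.2)
      (A.symm.continuous.comp ((hVc t ht.2).comp A.continuous))
  -- conclusion
  intro t ht0t ht x
  rcases eq_or_lt_of_le ht0t with h | h
  · subst h; exact hA x
  · have hx := congrFun (hVW t ⟨h, ht⟩) x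
    -- hx : V t x = A.symm (V t (A x))
    have := congrArg A hx
    rw [LinearIsometryEquiv.apply_symm_apply] at this
    exact this.symm

/-- Two equivariances give equivariance under the quotient `A ∘ B⁻¹`. -/
private theorem equivariant_comp_symm {U : (EuclideanSpace ℝ (Fin 3)) → (EuclideanSpace ℝ (Fin 3))} (A B : (EuclideanSpace ℝ (Fin 3)) ≃ₗᵢ[ℝ] (EuclideanSpace ℝ (Fin 3)))
    (hA : ∀ x, U (A x) = A (U x)) (hB : ∀ x, U (B x) = B (U x)) :
    ∀ x, U (A (B.symm x)) = A (B.symm (U x)) := by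
  intro x
  rw [hA]
  congr 1
  have h := hB (B.symm x)
  rw [LinearIsometryEquiv.apply_symm_apply] at h
  -- h : U x = B (U (B.symm x))
  have := congrArg B.symm h
  rw [LinearIsometryEquiv.symm_apply_apply] at this
  exact this.symm

/-! ### The rotating mirror -/

/-- The rotating mirror `R_φ ∘ g ∘ R_{−φ}` written as the linear isometry
`((rotZLIE (−φ)).trans g).trans (rotZLIE φ)` acts by `x ↦ R_φ (g (R_{−φ} x))`. -/
@[simp] theorem rotMirror_apply (g : (EuclideanSpace ℝ (Fin 3)) ≃ₗᵢ[ℝ] (EuclideanSpace ℝ (Fin 3))) (φ : ℝ) (x : (EuclideanSpace ℝ (Fin 3))) :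
    (((rotZLIE (-φ)).trans g).trans (rotZLIE φ)) x = rotZ φ (g (rotZ (-φ) x)) := rfl

/-- The inverse of the rotating mirror acts by `x ↦ R_φ (g⁻¹ (R_{−φ} x))`. -/
theorem rotMirror_symm_apply (g : (EuclideanSpace ℝ (Fin 3)) ≃ₗᵢ[ℝ] (EuclideanSpace ℝ (Fin 3))) (φ : ℝ) (x : (EuclideanSpace ℝ (Fin 3))) :
    ((((rotZLIE (-φ)).trans g).trans (rotZLIE φ))).symm x = rotZ φ (g.symm (rotZ (-φ) x)) := by
  apply ((((rotZLIE (-φ)).trans g).trans (rotZLIE φ))).injective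
  rw [LinearIsometryEquiv.apply_symm_apply, rotMirror_apply, ← rotZ_add, neg_add_cancel, rotZ_zero,
    LinearIsometryEquiv.apply_symm_apply, ← rotZ_add, add_neg_cancel, rotZ_zero]

/-- Group law: for a rotation-reversing `g`, `(R_φ g R_{−φ}) (R_ψ g R_{−ψ})⁻¹ = R_{2(φ−ψ)}`. -/
theorem rotMirror_comp_symm {g : (EuclideanSpace ℝ (Fin 3)) ≃ₗᵢ[ℝ] (EuclideanSpace ℝ (Fin 3))} (hg : ∀ φ y, g (rotZ φ y) = rotZ (-φ) (g y))
    (φ ψ : ℝ) (x : (EuclideanSpace ℝ (Fin 3))) :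
    (((rotZLIE (-φ)).trans g).trans (rotZLIE φ)) (((((rotZLIE (-ψ)).trans g).trans (rotZLIE ψ))).symm x) = rotZ (2 * (φ - ψ)) x := by
  rw [rotMirror_symm_apply, rotMirror_apply, ← rotZ_add, hg, LinearIsometryEquiv.apply_symm_apply,
    ← rotZ_add, ← rotZ_add]
  congr 1
  ring

/-- **T22′ (Oseen gauge): a mirror cannot rotate.** A Type-I ancient mild field with Type-I space–time
decay whose slice at log-time `s = −log(−t)` is equivariant under the rotating mirror `R_{αs} g R_{−αs}`
(`g` rotation-reversing, `α ≠ 0`) for every `t < 0` vanishes identically on `t < 0`. -/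
theorem rotatingMirror_trivial {C₀ α : ℝ} (hα : α ≠ 0) {g : (EuclideanSpace ℝ (Fin 3)) ≃ₗᵢ[ℝ] (EuclideanSpace ℝ (Fin 3))}
    (hg : ∀ φ y, g (rotZ φ y) = rotZ (-φ) (g y))
    {V : ℝ → (EuclideanSpace ℝ (Fin 3)) → (EuclideanSpace ℝ (Fin 3))} (hV : IsTypeIAncientMild C₀ V) (hdec : HasTypeIDecay C₀ V)
    (hsym : ∀ t < 0, ∀ x, V t ((((rotZLIE (-(α * -Real.log (-t)))).trans g).trans (rotZLIE (α * -Real.log (-t)))) x) =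
      (((rotZLIE (-(α * -Real.log (-t)))).trans g).trans (rotZLIE (α * -Real.log (-t)))) (V t x)) :
    ∀ t < 0, ∀ x, V t x = 0 := by
  have hVc : ∀ t < 0, Continuous (V t) := fun t ht => slice_continuous hV ht
  -- every slice is equivariant under a half-line of rotations
  have hequi : ∀ t < 0, ∀ σ : ℝ, 0 < σ → ∀ w,
      V t (rotZ (2 * (α * σ)) w) = rotZ (2 * (α * σ)) (V t w) := by
    intro t ht σ hσ w
    -- the earlier time `t₀` with log-time `s₀ = s − σ`
    set s : ℝ := -Real.log (-t) with hs
    set t₀ : ℝ := -Real.exp (-(s - σ)) with ht₀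
    have ht₀neg : t₀ < 0 := neg_neg_of_pos (Real.exp_pos _)
    have hlog₀ : -Real.log (-t₀) = s - σ := by
      rw [ht₀, neg_neg, Real.log_exp, neg_neg]
    have ht₀t : t₀ ≤ t := by
      have hts : t = -Real.exp (-s) := by
        rw [hs, neg_neg, Real.exp_log (by linarith), neg_neg]
      rw [hts, ht₀, neg_le_neg_iff]
      exact Real.exp_le_exp.2 (by linarith)
    -- propagate the `t₀`-mirror to time `t`
    have hprop := equivariant_of_le hV ((((rotZLIE (-(α * (s - σ)))).trans g).trans (rotZLIE (α * (s - σ))))) ht₀neg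
      (fun x => by have := hsym t₀ ht₀neg x; rw [hlog₀] at this; exact this) t ht₀t ht
    -- combine with the `t`-mirror
    have hnow : ∀ x, V t ((((rotZLIE (-(α * s))).trans g).trans (rotZLIE (α * s))) x) = (((rotZLIE (-(α * s))).trans g).trans (rotZLIE (α * s))) (V t x) := hsym t ht
    have hq := equivariant_comp_symm ((((rotZLIE (-(α * s))).trans g).trans (rotZLIE (α * s)))) ((((rotZLIE (-(α * (s - σ)))).trans g).trans (rotZLIE (α * (s - σ))))) hnow hprop w
    simp only [rotMirror_comp_symm hg] at hq
    have hang : 2 * (α * s - α * (s - σ)) = 2 * (α * σ) := by ring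
    rw [hang] at hq
    exact hq
  have hVax : ∀ t < 0, IsAxisymmetric (V t) := fun t ht =>
    ReversingIsotropy.isAxisymmetric_of_halfLine hα (hequi t ht)
  -- KNSS
  have hVmeas : ∀ t < 0, AEStronglyMeasurable (V t) volume := fun t ht =>
    (hVc t ht).aestronglyMeasurable
  intro t ht x
  have hz := typeI_ancient_axisymmetric_ae_zero hV.isAncientMildSolution hVmeas hdec hVax t ht
  have hV0 : V t = 0 := Measure.eq_of_ae_eq hz (hVc t ht) continuous_const
  exact congrFun hV0 x

/-! ### Co-rotating profiles (Pineau–Vicol ansatz with an `s`-dependent profile) -/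

/-- The slice at log-time `s` of `pvAnsatz α W` with `W(·, s)` `g`-equivariant is equivariant under the
rotating mirror `R_{αs} g R_{−αs}`. Pure algebra. -/
theorem pvAnsatz_rotMirror_equivariant {α : ℝ} {g : (EuclideanSpace ℝ (Fin 3)) ≃ₗᵢ[ℝ] (EuclideanSpace ℝ (Fin 3))}
    {W : (EuclideanSpace ℝ (Fin 3)) → ℝ → (EuclideanSpace ℝ (Fin 3))} (hGW : ∀ y s, W (g y) s = g (W y s)) (t : ℝ) (x : (EuclideanSpace ℝ (Fin 3))) :
    pvAnsatz α W t ((((rotZLIE (-(α * -Real.log (-t)))).trans g).trans (rotZLIE (α * -Real.log (-t)))) x) =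
      (((rotZLIE (-(α * -Real.log (-t)))).trans g).trans (rotZLIE (α * -Real.log (-t)))) (pvAnsatz α W t x) := by
  set φ : ℝ := α * -Real.log (-t) with hφ
  set s : ℝ := -Real.log (-t) with hs
  set lam : ℝ := (Real.sqrt (-t))⁻¹ with hlam
  have key : ∀ (c : ℝ) (w : (EuclideanSpace ℝ (Fin 3))), rotZ (-φ) (c • rotZ φ w) = c • w := fun c w => by
    rw [rotZ_smul'', ← rotZ_add, neg_add_cancel, rotZ_zero]
  have lhs : pvAnsatz α W t ((((rotZLIE (-φ)).trans g).trans (rotZLIE φ)) x) =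
      lam • rotZ φ (W (rotZ (-φ) (lam • rotZ φ (g (rotZ (-φ) x)))) s) := rfl
  have rhs : (((rotZLIE (-φ)).trans g).trans (rotZLIE φ)) (pvAnsatz α W t x) =
      rotZ φ (g (rotZ (-φ) (lam • rotZ φ (W (rotZ (-φ) (lam • x)) s)))) := rfl
  rw [lhs, rhs, key lam (g (rotZ (-φ) x)), key lam (W (rotZ (-φ) (lam • x)) s), ← g.map_smul,
    ← rotZ_smul'' (-φ) lam x, hGW, g.map_smul, rotZ_smul'' φ lam]

/-- **T22′ for co-rotating profiles.** A Type-I ancient mild field of the form `pvAnsatz α W`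
(co-rotating profile `W(y, s)`, arbitrary `s`-dependence — RDSS when `2 log c`-periodic, RSS when
constant), `α ≠ 0`, with `W(·, s)` equivariant under a fixed rotation-reversing isometry `g` for every
`s`, is trivial: `W = 0`. -/
theorem corotatingMirror_rdss_trivial {C₀ α : ℝ} (hα : α ≠ 0) {g : (EuclideanSpace ℝ (Fin 3)) ≃ₗᵢ[ℝ] (EuclideanSpace ℝ (Fin 3))}
    (hg : ∀ φ y, g (rotZ φ y) = rotZ (-φ) (g y))
    {V : ℝ → (EuclideanSpace ℝ (Fin 3)) → (EuclideanSpace ℝ (Fin 3))} (hV : IsTypeIAncientMild C₀ V) (hdec : HasTypeIDecay C₀ V)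
    {W : (EuclideanSpace ℝ (Fin 3)) → ℝ → (EuclideanSpace ℝ (Fin 3))} (hGW : ∀ y s, W (g y) s = g (W y s))
    (hans : ∀ t < 0, ∀ x, V t x = pvAnsatz α W t x) : W = 0 := by
  have hsym : ∀ t < 0, ∀ x, V t ((((rotZLIE (-(α * -Real.log (-t)))).trans g).trans (rotZLIE (α * -Real.log (-t)))) x) =
      (((rotZLIE (-(α * -Real.log (-t)))).trans g).trans (rotZLIE (α * -Real.log (-t)))) (V t x) := by
    intro t ht x
    rw [hans t ht, hans t ht]
    exact pvAnsatz_rotMirror_equivariant hGW t x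
  have hzero := rotatingMirror_trivial hα hg hV hdec hsym
  funext y s
  set t : ℝ := -Real.exp (-s) with ht
  have htneg : t < 0 := neg_neg_of_pos (Real.exp_pos _)
  have hlog : -Real.log (-t) = s := by rw [ht, neg_neg, Real.log_exp, neg_neg]
  have hsq : 0 < Real.sqrt (-t) := Real.sqrt_pos.2 (by linarith)
  -- evaluate the (vanishing) slice at the point whose co-rotating coordinate is `y`
  have h := hzero t htneg (Real.sqrt (-t) • rotZ (α * s) y)
  rw [hans t htneg] at h
  simp only [pvAnsatz, hlog, smul_smul, inv_mul_cancel₀ hsq.ne', one_smul,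
    ← rotZ_add, neg_add_cancel, rotZ_zero] at h
  -- h : (√(-t))⁻¹ • rotZ (α s) (W y s) = 0
  have h2 : rotZ (α * s) (W y s) = 0 := by
    rcases smul_eq_zero.1 h with h0 | h0
    · exact absurd h0 (inv_ne_zero hsq.ne')
    · exact h0
  have h3 := congrArg (rotZ (-(α * s))) h2
  rw [← rotZ_add, neg_add_cancel, rotZ_zero] at h3
  rw [h3]
  show rotZ (-(α * s)) 0 = (0 : (EuclideanSpace ℝ (Fin 3)) → ℝ → (EuclideanSpace ℝ (Fin 3))) y s
  have : rotZ (-(α * s)) (0 : (EuclideanSpace ℝ (Fin 3))) = 0 := by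
    rw [show (0 : (EuclideanSpace ℝ (Fin 3))) = (0 : ℝ) • (0 : (EuclideanSpace ℝ (Fin 3))) by simp, rotZ_smul'', zero_smul, zero_smul]
  rw [this]; rfl

/-- T22 (`s`-independent co-rotating profile) is the special case `W y s = U y`. -/
theorem mirrorCorotating_trivial_of_rdss {C₀ α : ℝ} (hα : α ≠ 0) {g : (EuclideanSpace ℝ (Fin 3)) ≃ₗᵢ[ℝ] (EuclideanSpace ℝ (Fin 3))}
    (hg : ∀ φ y, g (rotZ φ y) = rotZ (-φ) (g y))
    {V : ℝ → (EuclideanSpace ℝ (Fin 3)) → (EuclideanSpace ℝ (Fin 3))} (hV : IsTypeIAncientMild C₀ V) (hdec : HasTypeIDecay C₀ V)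
    {U : (EuclideanSpace ℝ (Fin 3)) → (EuclideanSpace ℝ (Fin 3))} (hGU : ∀ y, U (g y) = g (U y))
    (hans : ∀ t < 0, ∀ x, V t x = pvAnsatz α (fun y _ => U y) t x) : U = 0 := by
  have h := corotatingMirror_rdss_trivial hα hg hV hdec (W := fun y _ => U y) (fun y _ => hGU y) hans
  funext y
  exact congrFun (congrFun h y) 0

/-- **T22′ at CLASS level.** A member of the census class (ancient mild, measurable slices, Type-I `M`)
that is a co-rotating field `pvAnsatz α W` (`α ≠ 0`) with continuous profile slices `W(·, s)`, each
equivariant under a fixed rotation-reversing isometry, has `W = 0`. -/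
theorem rdssClass_corotatingMirror_empty {M α : ℝ} (hα : α ≠ 0) {g : (EuclideanSpace ℝ (Fin 3)) ≃ₗᵢ[ℝ] (EuclideanSpace ℝ (Fin 3))}
    (hg : ∀ φ y, g (rotZ φ y) = rotZ (-φ) (g y)) {W : (EuclideanSpace ℝ (Fin 3)) → ℝ → (EuclideanSpace ℝ (Fin 3))}
    (hW : ∀ s, Continuous fun y => W y s) (hGW : ∀ y s, W (g y) s = g (W y s))
    {u : ℝ → (EuclideanSpace ℝ (Fin 3)) → (EuclideanSpace ℝ (Fin 3))} (hmild : IsAncientMildSolution 1 u)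
    (hmeas : ∀ t < 0, AEStronglyMeasurable (u t) volume) (hdec : HasTypeIDecay M u)
    (hans : ∀ t < 0, ∀ x, u t x = pvAnsatz α W t x) : W = 0 := by
  obtain ⟨V, hT, hVdec, hVu, -⟩ := typeI_ancient_smoothRepresentative_ae hmild hmeas hdec
  have hVc : ∀ t < 0, Continuous (V t) := fun t ht => slice_continuous hT ht
  have huc : ∀ t < 0, Continuous (u t) := fun t ht => by
    have : u t = fun x => pvAnsatz α W t x := funext (hans t ht)
    rw [this]
    exact ((continuous_rotZ_map' _).comp ((hW _).comp ((continuous_rotZ_map' _).comp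
      (continuous_const_smul ((Real.sqrt (-t))⁻¹ : ℝ))))).const_smul ((Real.sqrt (-t))⁻¹ : ℝ)
  have hVeq : ∀ t < 0, V t = u t := fun t ht => Measure.eq_of_ae_eq (hVu t ht) (hVc t ht) (huc t ht)
  exact corotatingMirror_rdss_trivial hα hg hT hVdec hGW fun t ht x => by
    rw [hVeq t ht]; exact hans t ht x

/-- Remark 1.2 of Pineau–Vicol on all of `t < 0`: a profile bound `‖W(y,s)‖ ≤ C₀/(1+‖y‖)` for all
`y, s` gives the Type-I bound with constant `C₀` for the ansatz field at every `t < 0`.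
[cite: PineauVicol2026, Remark 1.2 (pp. 3–4) and Lemma 7.1 (p. 24)] -/
theorem hasTypeIDecay_pvAnsatz_of_profile {C₀ α : ℝ} {W : (EuclideanSpace ℝ (Fin 3)) → ℝ → (EuclideanSpace ℝ (Fin 3))}
    (hW : ∀ (y : (EuclideanSpace ℝ (Fin 3))) (s : ℝ), ‖W y s‖ ≤ C₀ / (1 + ‖y‖)) : HasTypeIDecay C₀ (pvAnsatz α W) := by
  intro t ht x
  have hr : 0 < Real.sqrt (-t) := Real.sqrt_pos.2 (by linarith)
  rw [PineauVicol2026.norm_pvAnsatz]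
  have hy := hW (rotZ (-(α * -Real.log (-t))) ((Real.sqrt (-t))⁻¹ • x)) (-Real.log (-t))
  rw [norm_rotZ, norm_smul, norm_inv, Real.norm_of_nonneg hr.le] at hy
  calc (Real.sqrt (-t))⁻¹ *
        ‖W (rotZ (-(α * -Real.log (-t))) ((Real.sqrt (-t))⁻¹ • x)) (-Real.log (-t))‖
      ≤ (Real.sqrt (-t))⁻¹ * (C₀ / (1 + (Real.sqrt (-t))⁻¹ * ‖x‖)) :=
        mul_le_mul_of_nonneg_left hy (inv_nonneg.2 hr.le)
    _ = C₀ / (‖x‖ + Real.sqrt (-t)) := by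
        field_simp
        ring

/-- **T22′ in the window-classical phrasing of Pineau–Vicol 2026 Thm 1.7's setting (RDSS).** A classical
solution on `(EuclideanSpace ℝ (Fin 3)) × [−1, 0)` with the Type-I bound (1.10), backwards rotated DSS in the form (1.13a) with
angular speed `α ≠ 0`, factor `c > 1` and an `s`-periodic co-rotating profile `W` (period `2 log c`) whose
slices `W(·, s)` are equivariant under a fixed rotation-reversing isometry, has `W ≡ 0`. Proof: extend to
the past (`PineauVicol2026.exists_isClassicalNSSolutionOn_Iio_of_isRotatedDSS`), transfer the Type-I bound
to every `t < 0` (`PineauVicol2026.norm_profile_le_of_typeI_periodic` + Remark 1.2), pass to the KNSS gauge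
(`isTypeIAncientMild_of_classical_typeI`) and apply `corotatingMirror_rdss_trivial`. -/
theorem corotatingMirror_rdss_liouville {C₀ α c : ℝ} (hα : α ≠ 0) (hc : 1 < c) {g : (EuclideanSpace ℝ (Fin 3)) ≃ₗᵢ[ℝ] (EuclideanSpace ℝ (Fin 3))}
    (hg : ∀ φ y, g (rotZ φ y) = rotZ (-φ) (g y)) {u : ℝ → (EuclideanSpace ℝ (Fin 3)) → (EuclideanSpace ℝ (Fin 3))} {p : ℝ → (EuclideanSpace ℝ (Fin 3)) → ℝ}
    {W : (EuclideanSpace ℝ (Fin 3)) → ℝ → (EuclideanSpace ℝ (Fin 3))} (hsol : IsClassicalNSSolutionOn (Ico (-1) 0) 1 0 u p)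
    (hI : ∀ t ∈ Ico (-1 : ℝ) 0, ∀ x, ‖u t x‖ ≤ C₀ / (‖x‖ + Real.sqrt (-t)))
    (hper : ∀ (y : (EuclideanSpace ℝ (Fin 3))) (s : ℝ), W y (s + 2 * Real.log c) = W y s)
    (hGW : ∀ y s, W (g y) s = g (W y s))
    (hans : ∀ t ∈ Ico (-1 : ℝ) 0, ∀ x, u t x = pvAnsatz α W t x) : W = 0 := by
  obtain ⟨P, hP⟩ := PineauVicol2026.exists_isClassicalNSSolutionOn_Iio_of_isRotatedDSS hsol
    hc (PineauVicol2026.isRotatedDSS_pvAnsatz (α := α) (U := W) (lt_trans zero_lt_one hc) hper) hans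
  have hprof : ∀ (y : (EuclideanSpace ℝ (Fin 3))) (s : ℝ), ‖W y s‖ ≤ C₀ / (1 + ‖y‖) :=
    PineauVicol2026.norm_profile_le_of_typeI_periodic hc hI hper hans
  have hIw : HasTypeIDecay C₀ (pvAnsatz α W) := hasTypeIDecay_pvAnsatz_of_profile hprof
  exact corotatingMirror_rdss_trivial hα hg
    (PolyhedralDssProfileExists.Birth.isTypeIAncientMild_of_classical_typeI hP hIw) hIw hGW
    fun t _ x => rfl

end Summit.NavierStokesRegularity.NavierStokesRegularity.Theorems.RotatingMirror

end
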